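import Mathlib.FieldTheory.Finite.Basic
import Mathlib.Tactic
import HarnessLib

/-!
# `x^m + y^m = z^m` forces `2m + 1 ∣ xyz`, `4m + 1 ∣ xyz` when these are prime (Ribenboim, Ch. IV (1H), (1I))

P. Ribenboim, *Fermat's Last Theorem for Amateurs* (1999) [Ribenboim1999FLTAmateurs], Ch. IV, §1:

* **(1H)** (Thébault 1937; Stone, Gandhi): if `m ≥ 2` and `2m + 1` is prime, and `x, y, z` are
  non-zero pairwise coprime integers with `x^m + y^m = z^m`, then `2m + 1 ∣ xyz`;
* **(1I)** (Gandhi 1965): the same with `4m + 1` prime.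

Everything here is a `theorem`; the proofs are the printed ones (Fermat's little theorem makes
`x^m ≡ ±1`, resp. `x^{2m} ≡ ±1`, modulo the prime, and `±1 ± 1 ∓ 1 ≢ 0`, resp. squaring
`x^m + y^m = z^m` twice leaves `q ∣ 3·5`). The coprimality hypotheses are not needed and are dropped;
in (1I) the printed separate treatment of `m = 3` is unnecessary for the congruence argument as run
here (the residual primes are `3, 5` only).
-/

namespace Literature.NumberTheory.DiophantineGeometry

namespace FermatAuxiliaryPrime

/-- In a field, `t² = 1` forces `t = ±1`. [folklore] -/
private theorem sq_eq_one {F : Type*} [Field F] {t : F} (h : t ^ 2 = 1) : t = 1 ∨ t = -1 := by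
  have : (t - 1) * (t + 1) = 0 := by linear_combination h
  rcases mul_eq_zero.mp this with h | h
  · left; linear_combination h
  · right; linear_combination h

/-- Fermat: for a prime `q = km + 1` and `q ∤ x`, `(x^m)^k = 1` in `𝔽_q`. [folklore] -/
private theorem pow_pow_eq_one {m k : ℕ} {q : ℕ} [Fact q.Prime] (hq : q = k * m + 1) {x : ℤ}
    (hx : ¬ (q : ℤ) ∣ x) : ((x : ZMod q) ^ m) ^ k = 1 := by
  have hx0 : (x : ZMod q) ≠ 0 := by rwa [Ne, ZMod.intCast_zmod_eq_zero_iff_dvd]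
  rw [← pow_mul, show m * k = q - 1 by rw [hq, mul_comm]; simp]
  exact ZMod.pow_card_sub_one_eq_one hx0

/-- `(n : ZMod q) = 0` for a numeral means `q ∣ n`. [folklore] -/
private theorem dvd_of_cast_eq_zero {q n : ℕ} (h : ((n : ℕ) : ZMod q) = 0) : q ∣ n :=
  (ZMod.natCast_eq_zero_iff n q).mp h

/-- **Ribenboim, Ch. IV (1H).** If `m ≥ 2`, `2m + 1` is prime and `x^m + y^m = z^m`, then
`2m + 1 ∣ xyz`. [cite: Ribenboim1999FLTAmateurs, Ch. IV (1H)] -/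
theorem dvd_of_prime_two_mul_add_one {m : ℕ} (hm : 2 ≤ m) (hq : (2 * m + 1).Prime) {x y z : ℤ}
    (h : x ^ m + y ^ m = z ^ m) : ((2 * m + 1 : ℕ) : ℤ) ∣ x * y * z := by
  haveI := Fact.mk hq
  set q := 2 * m + 1 with hqdef
  have hq' : Prime (q : ℤ) := Nat.prime_iff_prime_int.mp hq
  by_contra hxyz
  have hx : ¬ (q : ℤ) ∣ x := fun d => hxyz (by rw [mul_assoc]; exact d.mul_right _)
  have hy : ¬ (q : ℤ) ∣ y := fun d => hxyz ((d.mul_left x).mul_right z)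
  have hz : ¬ (q : ℤ) ∣ z := fun d => hxyz (d.mul_left _)
  have hu := sq_eq_one (pow_pow_eq_one (k := 2) hqdef hx)
  have hv := sq_eq_one (pow_pow_eq_one (k := 2) hqdef hy)
  have hw := sq_eq_one (pow_pow_eq_one (k := 2) hqdef hz)
  have e : ((x : ZMod q) ^ m) + ((y : ZMod q) ^ m) = ((z : ZMod q) ^ m) := by
    have := congrArg (Int.cast : ℤ → ZMod q) h
    push_cast at this
    exact this
  -- `±1 ± 1 = ±1` forces `q ∣ 1` or `q ∣ 3`
  have h3 : q ∣ 3 ∨ q ∣ 1 := by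
    rcases hu with hu | hu <;> rcases hv with hv | hv <;> rcases hw with hw | hw <;>
      rw [hu, hv, hw] at e
    all_goals first
      | exact Or.inr (dvd_of_cast_eq_zero (by push_cast; linear_combination e))
      | exact Or.inl (dvd_of_cast_eq_zero (by push_cast; linear_combination e))
      | exact Or.inl (dvd_of_cast_eq_zero (by push_cast; linear_combination -e))
      | exact Or.inr (dvd_of_cast_eq_zero (by push_cast; linear_combination -e))
  rcases h3 with h3 | h1
  · have := Nat.le_of_dvd (by norm_num) h3; omega
  · have := Nat.le_of_dvd (by norm_num) h1; omega

/-- **Ribenboim, Ch. IV (1I).** If `m ≥ 2`, `4m + 1` is prime and `x^m + y^m = z^m`, then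
`4m + 1 ∣ xyz`. [cite: Ribenboim1999FLTAmateurs, Ch. IV (1I)] -/
theorem dvd_of_prime_four_mul_add_one {m : ℕ} (hm : 2 ≤ m) (hq : (4 * m + 1).Prime) {x y z : ℤ}
    (h : x ^ m + y ^ m = z ^ m) : ((4 * m + 1 : ℕ) : ℤ) ∣ x * y * z := by
  haveI := Fact.mk hq
  set q := 4 * m + 1 with hqdef
  by_contra hxyz
  have hx : ¬ (q : ℤ) ∣ x := fun d => hxyz (by rw [mul_assoc]; exact d.mul_right _)
  have hy : ¬ (q : ℤ) ∣ y := fun d => hxyz ((d.mul_left x).mul_right z)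
  have hz : ¬ (q : ℤ) ∣ z := fun d => hxyz (d.mul_left _)
  -- `s₁ = x^{2m}`, `s₂ = y^{2m}`, `s₃ = z^{2m}` are `±1`
  set u : ZMod q := (x : ZMod q) ^ m with hudef
  set v : ZMod q := (y : ZMod q) ^ m with hvdef
  set w : ZMod q := (z : ZMod q) ^ m with hwdef
  have hu4 : (u ^ 2) ^ 2 = 1 := by rw [← pow_mul]; exact pow_pow_eq_one (k := 4) hqdef hx
  have hv4 : (v ^ 2) ^ 2 = 1 := by rw [← pow_mul]; exact pow_pow_eq_one (k := 4) hqdef hy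
  have hw4 : (w ^ 2) ^ 2 = 1 := by rw [← pow_mul]; exact pow_pow_eq_one (k := 4) hqdef hz
  have e : u + v = w := by
    have := congrArg (Int.cast : ℤ → ZMod q) h
    push_cast at this
    exact this
  -- `2uv = w² − u² − v²` and `4u²v² = (w² − u² − v²)²`, so `2(s₁s₂ + s₁s₃ + s₂s₃) = 3`
  have key : ∀ s₁ s₂ s₃ : ZMod q, u ^ 2 = s₁ → v ^ 2 = s₂ → w ^ 2 = s₃ →
      4 * s₁ * s₂ = (s₃ - s₁ - s₂) ^ 2 := by
    intro s₁ s₂ s₃ h1 h2 h3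
    have h2uv : 2 * u * v = s₃ - s₁ - s₂ := by
      linear_combination (u + v + w) * e - h1 - h2 + h3
    have : 4 * (u ^ 2) * (v ^ 2) = (2 * u * v) ^ 2 := by ring
    rw [h1, h2, h2uv] at this
    exact this
  have h15 : q ∣ 3 ∨ q ∣ 5 := by
    rcases sq_eq_one hu4 with h1 | h1 <;> rcases sq_eq_one hv4 with h2 | h2 <;>
      rcases sq_eq_one hw4 with h3 | h3
    all_goals
      have k := key _ _ _ h1 h2 h3
      norm_num at k
      first
        | exact Or.inl (dvd_of_cast_eq_zero (by push_cast; linear_combination k))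
        | exact Or.inl (dvd_of_cast_eq_zero (by push_cast; linear_combination -k))
        | exact Or.inr (dvd_of_cast_eq_zero (by push_cast; linear_combination k))
        | exact Or.inr (dvd_of_cast_eq_zero (by push_cast; linear_combination -k))
  rcases h15 with h3 | h5
  · have := Nat.le_of_dvd (by norm_num) h3; omega
  · have := Nat.le_of_dvd (by norm_num) h5; omega

end FermatAuxiliaryPrime

end Literature.NumberTheory.DiophantineGeometry
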